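import Mathlib
import Summits.KontsevichZagierPeriods.KontsevichZagierPeriods.Theorems.InverseLandauTateFamilyKernelStubTwoFaceDensityZero
import Summits.KontsevichZagierPeriods.KontsevichZagierPeriods.Theorems.InverseLandauTateFamilyKernelStubDigitsMv
import Summits.KontsevichZagierPeriods.KontsevichZagierPeriods.Theorems.InverseLandauTateFamilyKernelStubFaceQuotient

/-!
# Crux `TateFamilyKernel` (stmt-KontsevichZagierPeriods-9130), line `Sketch` — `stub_faceRemaindersVanish`
# (wave 15, lead c4: both face remainders vanish — assembly of two landed lemmas)

For the Euler sector of the lead's skeleton of the crux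
`Summit.KontsevichZagierPeriods.KontsevichZagierPeriods.Theses.InverseLandau.TateFamilyKernel`:
with monotone faces `τ_a, τ_b ∈ ℚ[s]` (strictly increasing and positive on `[0,1]`) and the corner
condition `τ_a(0) < τ_b(0)`, a rational identity `B·[∫₀¹ f_a/(1−ϖτ_a) + ∫₀¹ f_b/(1−ϖτ_b)] = A` on
`(0,b)` for the `ϖ`-independent densities `f_a(s) = (c_bÃ)(s,1/τ_a(s))`, `f_b(s) = (c_aB̃)(s,1/τ_b(s))`
(`c_a, c_b ∈ ℚ[ϖ] ∖ 0`, `deg_s Ã < deg τ_a`, `deg_s B̃ < deg τ_b`) forces `Ã = B̃ = 0`: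

1. `stub_twoFaceDensityZero` (landed) kills `f_a` on `{s ∈ [0,1] : τ_a(s) < τ_b(0)}`, which by
   continuity of `τ_a` at `0` contains an interval `(0, u) ∩ (0, 1)`, an infinite set; `stub_digitsMv`
   (landed) gives `c_b·Ã = 0` (`deg_s (c_b Ã) ≤ deg_s Ã` since `c_b(ϖ)` is free of `s`), and `c_b ≠ 0`
   gives `Ã = 0` (`ϖ = X 1` is transcendental, `ℚ[s,ϖ]` is a domain);
2. then `f_a ≡ 0`, the identity reads `B·[∫₀¹ f_b/(1−ϖτ_b) + ∫₀¹ 0/(1−ϖ(τ_b + 3/b))] = A` on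
   `(0, b/4)` with the dummy far face `τ_b + 3/b`, and `stub_twoFaceDensityZero` kills `f_b` on
   `{τ_b(s) < τ_b(0) + 3/b} = [0,1]` (`|τ_b| ≤ 1/b`); `stub_digitsMv` on `[0,1]` gives `c_a·B̃ = 0`,
   hence `B̃ = 0`.

Variables: `X 0 = s`, `X 1 = ϖ`. Mathlib + the three landed files; no named fact, no new definition;
helpers in the sub-namespace `FaceRemaindersVanish`.
-/

noncomputable section

open MeasureTheory Set MvPolynomial

namespace Summit.KontsevichZagierPeriods.InverseLandau.TateFamilyKernel.Descent

namespace FaceRemaindersVanish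

/-- A polynomial in `ϖ = X 1` alone has `s`-degree `0`: `deg_s c(ϖ) = 0`. [folklore] -/
theorem degreeOf_zero_aeval_X_one (q : Polynomial ℚ) :
    (Polynomial.aeval (X 1 : MvPolynomial (Fin 2) ℚ) q).degreeOf 0 = 0 := by
  rw [Polynomial.aeval_eq_sum_range]
  refine Nat.eq_zero_of_le_zero ((degreeOf_sum_le _ _ _).trans (Finset.sup_le fun i _ => ?_))
  rw [smul_eq_C_mul]
  refine (degreeOf_C_mul_le _ _ _).trans (le_of_eq ?_)
  exact degreeOf_X_pow_of_ne i (by decide)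

/-- Multiplying by a polynomial in `ϖ` alone does not raise the `s`-degree:
`deg_s (c(ϖ)·R) ≤ deg_s R`. [folklore] -/
theorem degreeOf_zero_aeval_mul_le (q : Polynomial ℚ) (R : MvPolynomial (Fin 2) ℚ) :
    (Polynomial.aeval (X 1 : MvPolynomial (Fin 2) ℚ) q * R).degreeOf 0 ≤ R.degreeOf 0 := by
  refine (degreeOf_mul_le _ _ _).trans ?_
  rw [degreeOf_zero_aeval_X_one, zero_add]

/-- Cancelling a non-zero scalar `c(ϖ)`: `c ≠ 0` and `c(ϖ)·R = 0` in `ℚ[s,ϖ]` force `R = 0`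
(`X 1` is transcendental over `ℚ`, so `c ↦ c(X 1)` is injective, and `ℚ[s,ϖ]` is a domain).
[folklore] -/
theorem eq_zero_of_aeval_mul_eq_zero {q : Polynomial ℚ} (hq : q ≠ 0) {R : MvPolynomial (Fin 2) ℚ}
    (h : Polynomial.aeval (X 1 : MvPolynomial (Fin 2) ℚ) q * R = 0) : R = 0 :=
  (mul_eq_zero.1 h).resolve_left fun h0 => hq
    (transcendental_iff_injective.1 (MvPolynomial.transcendental_X ℚ (1 : Fin 2))
      (h0.trans (map_zero (Polynomial.aeval (X 1 : MvPolynomial (Fin 2) ℚ))).symm))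

/-- The `ϖ`-independent face density `s ↦ N(s, 1/τ(s))` is continuous on `[0,1]` when `τ ≠ 0`
there. [folklore] -/
theorem continuousOn_density (τ : Polynomial ℚ) (N : MvPolynomial (Fin 2) ℚ)
    (hτ : ∀ s ∈ Icc (0 : ℝ) 1, Polynomial.aeval s τ ≠ 0) :
    ContinuousOn (fun s : ℝ => aeval (![s, (Polynomial.aeval s τ)⁻¹] : Fin 2 → ℝ) N) (Icc 0 1) :=
  (FaceQuotient.continuous_aeval N).comp_continuousOn (continuousOn_id.matrixVecCons
    (((Polynomial.continuousOn_aeval τ).inv₀ hτ).matrixVecCons continuousOn_const))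

end FaceRemaindersVanish

/-- **Stub `stub_faceRemaindersVanish`** (wave 15, assembly of the analytic core). **Both face
remainders vanish.** With monotone faces (`τ_a, τ_b` strictly increasing and positive on `[0,1]`)
and the corner condition `τ_a(0) < τ_b(0)`, a rational identity
`B·[∫ f_a/(1−ϖτ_a) + ∫ f_b/(1−ϖτ_b)] = A` on `(0,b)` for the densities `f_a = (c_bÃ)(s,1/τ_a(s))`,
`f_b = (c_aB̃)(s,1/τ_b(s))` (`c_a, c_b ≠ 0`, `deg_s Ã < deg τ_a`, `deg_s B̃ < deg τ_b`) forces
`Ã = B̃ = 0`: `stub_twoFaceDensityZero` kills `f_a` on `{τ_a(s) < τ_b(0)} ⊇ (0,u) ∩ (0,1)`,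
`stub_digitsMv` gives `c_bÃ = 0`, hence `Ã = 0`; then `f_a ≡ 0`, the identity involves `f_b`
alone, `stub_twoFaceDensityZero` with the dummy far face `τ_b + 3/b` on `(0, b/4)` kills `f_b`
on `[0,1]`, and `stub_digitsMv` gives `c_aB̃ = 0`, hence `B̃ = 0`. [folklore] -/
theorem stub_faceRemaindersVanish (τa τb : Polynomial ℚ) (hdega : 0 < τa.natDegree)
    (hdegb : 0 < τb.natDegree)
    (hτa : ∀ s ∈ Icc (0 : ℝ) 1, 0 < Polynomial.aeval s τa)
    (hτb : ∀ s ∈ Icc (0 : ℝ) 1, 0 < Polynomial.aeval s τb)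
    (hma : StrictMonoOn (fun s : ℝ => Polynomial.aeval s τa) (Icc 0 1))
    (hmb : StrictMonoOn (fun s : ℝ => Polynomial.aeval s τb) (Icc 0 1))
    (hcorner : Polynomial.aeval (0 : ℝ) τa < Polynomial.aeval (0 : ℝ) τb)
    (RA RB : MvPolynomial (Fin 2) ℚ) (ca cb : Polynomial ℚ) (hca : ca ≠ 0) (hcb : cb ≠ 0)
    (hRA : RA.degreeOf 0 < τa.natDegree) (hRB : RB.degreeOf 0 < τb.natDegree)
    (A B : Polynomial ℝ) (b : ℝ) (hb : 0 < b) (hB : B ≠ 0)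
    (hbd : ∀ s ∈ Icc (0 : ℝ) 1, |Polynomial.aeval s τa| * b ≤ 1 ∧ |Polynomial.aeval s τb| * b ≤ 1)
    (hid : ∀ ϖ ∈ Ioo (0 : ℝ) b, B.eval ϖ *
        ((∫ s in (0 : ℝ)..1, aeval (![s, (Polynomial.aeval s τa)⁻¹] : Fin 2 → ℝ)
            (Polynomial.aeval (X 1 : MvPolynomial (Fin 2) ℚ) cb * RA) /
              (1 - ϖ * Polynomial.aeval s τa)) +
          ∫ s in (0 : ℝ)..1, aeval (![s, (Polynomial.aeval s τb)⁻¹] : Fin 2 → ℝ)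
            (Polynomial.aeval (X 1 : MvPolynomial (Fin 2) ℚ) ca * RB) /
              (1 - ϖ * Polynomial.aeval s τb)) =
        A.eval ϖ) :
    RA = 0 ∧ RB = 0 := by
  have hτ0a : ∀ s ∈ Icc (0 : ℝ) 1, Polynomial.aeval s τa ≠ 0 := fun s hs => (hτa s hs).ne'
  have hτ0b : ∀ s ∈ Icc (0 : ℝ) 1, Polynomial.aeval s τb ≠ 0 := fun s hs => (hτb s hs).ne'
  have hrg : ∀ {t : ℝ}, |t| * b ≤ 1 → |t| ≤ b⁻¹ := fun h => by rwa [← one_div, le_div_iff₀ hb]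
  -- (A) the `a`-density vanishes wherever `τa s < τb 0`
  have hfa0 : ∀ s ∈ Icc (0 : ℝ) 1, Polynomial.aeval s τa < Polynomial.aeval (0 : ℝ) τb →
      aeval (![s, (Polynomial.aeval s τa)⁻¹] : Fin 2 → ℝ)
        (Polynomial.aeval (X 1 : MvPolynomial (Fin 2) ℚ) cb * RA) = 0 :=
    stub_twoFaceDensityZero
      (fun s => aeval (![s, (Polynomial.aeval s τa)⁻¹] : Fin 2 → ℝ)
        (Polynomial.aeval (X 1 : MvPolynomial (Fin 2) ℚ) cb * RA))
      (fun s => aeval (![s, (Polynomial.aeval s τb)⁻¹] : Fin 2 → ℝ)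
        (Polynomial.aeval (X 1 : MvPolynomial (Fin 2) ℚ) ca * RB))
      (fun s => Polynomial.aeval s τa) (fun s => Polynomial.aeval s τb) b hb
      (FaceRemaindersVanish.continuousOn_density τa _ hτ0a)
      (FaceRemaindersVanish.continuousOn_density τb _ hτ0b)
      (Polynomial.continuousOn_aeval τa) (Polynomial.continuousOn_aeval τb) hma hmb hbd A B hB hid
  -- an infinite set of such `s`: an interval `(0, min u 1)` (continuity of `τa` at `0`, corner)
  obtain ⟨l, u, hlu, hsub⟩ := mem_nhds_iff_exists_Ioo_subset.1
    (Filter.Tendsto.eventually_lt_const hcorner (Polynomial.continuous_aeval τa).continuousAt)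
  have hS1 : ∀ s ∈ Ioo (0 : ℝ) (min u 1), s ∈ Icc (0 : ℝ) 1 := fun s hs =>
    ⟨hs.1.le, (lt_min_iff.1 hs.2).2.le⟩
  have hS2 : ∀ s ∈ Ioo (0 : ℝ) (min u 1), Polynomial.aeval s τa < Polynomial.aeval (0 : ℝ) τb :=
    fun s hs => hsub ⟨hlu.1.trans hs.1, (lt_min_iff.1 hs.2).1⟩
  have hPA : Polynomial.aeval (X 1 : MvPolynomial (Fin 2) ℚ) cb * RA = 0 :=
    stub_digitsMv τa hdega _ ((FaceRemaindersVanish.degreeOf_zero_aeval_mul_le cb RA).trans_lt hRA)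
      (Ioo 0 (min u 1)) (Ioo_infinite (lt_min hlu.2 zero_lt_one)) (fun s hs => hτ0a s (hS1 s hs))
      fun s hs => hfa0 s (hS1 s hs) (hS2 s hs)
  have hRA0 : RA = 0 := FaceRemaindersVanish.eq_zero_of_aeval_mul_eq_zero hcb hPA
  refine ⟨hRA0, ?_⟩
  -- (B) with `Ã = 0` the identity involves `f_b` alone; dummy far face `τb + 3/b` on `(0, b/4)`
  have hbd' : ∀ s ∈ Icc (0 : ℝ) 1, |Polynomial.aeval s τb| * (b / 4) ≤ 1 ∧
      |Polynomial.aeval s τb + 3 * b⁻¹| * (b / 4) ≤ 1 := by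
    intro s hs
    have h1 : |Polynomial.aeval s τb| ≤ b⁻¹ := hrg (hbd s hs).2
    have hb1 : b⁻¹ * b = 1 := inv_mul_cancel₀ hb.ne'
    have hbi : 0 < b⁻¹ := inv_pos.2 hb
    have h2 : |Polynomial.aeval s τb + 3 * b⁻¹| ≤ 4 * b⁻¹ := by
      refine (abs_add_le _ _).trans ?_
      rw [abs_of_pos (by positivity : (0 : ℝ) < 3 * b⁻¹)]
      linarith
    constructor
    · calc |Polynomial.aeval s τb| * (b / 4) ≤ b⁻¹ * (b / 4) :=
            mul_le_mul_of_nonneg_right h1 (by positivity)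
        _ = b⁻¹ * b / 4 := by ring
        _ ≤ 1 := by rw [hb1]; norm_num
    · calc |Polynomial.aeval s τb + 3 * b⁻¹| * (b / 4) ≤ 4 * b⁻¹ * (b / 4) :=
            mul_le_mul_of_nonneg_right h2 (by positivity)
        _ = b⁻¹ * b := by ring
        _ ≤ 1 := hb1.le
  have hid' : ∀ ϖ ∈ Ioo (0 : ℝ) (b / 4), B.eval ϖ *
      ((∫ s in (0 : ℝ)..1, aeval (![s, (Polynomial.aeval s τb)⁻¹] : Fin 2 → ℝ)
          (Polynomial.aeval (X 1 : MvPolynomial (Fin 2) ℚ) ca * RB) /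
            (1 - ϖ * Polynomial.aeval s τb)) +
        ∫ s in (0 : ℝ)..1, (0 : ℝ) / (1 - ϖ * (Polynomial.aeval s τb + 3 * b⁻¹))) = A.eval ϖ := by
    intro ϖ hϖ
    have h := hid ϖ ⟨hϖ.1, hϖ.2.trans_le (by linarith)⟩
    simp only [hRA0, mul_zero, map_zero, zero_div, intervalIntegral.integral_zero, zero_add] at h
    simpa only [zero_div, intervalIntegral.integral_zero, add_zero] using h
  have hfb0 : ∀ s ∈ Icc (0 : ℝ) 1, aeval (![s, (Polynomial.aeval s τb)⁻¹] : Fin 2 → ℝ)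
      (Polynomial.aeval (X 1 : MvPolynomial (Fin 2) ℚ) ca * RB) = 0 := by
    intro s hs
    refine stub_twoFaceDensityZero
      (fun s => aeval (![s, (Polynomial.aeval s τb)⁻¹] : Fin 2 → ℝ)
        (Polynomial.aeval (X 1 : MvPolynomial (Fin 2) ℚ) ca * RB))
      (fun _ => 0) (fun s => Polynomial.aeval s τb) (fun s => Polynomial.aeval s τb + 3 * b⁻¹)
      (b / 4) (by positivity) (FaceRemaindersVanish.continuousOn_density τb _ hτ0b)
      continuousOn_const (Polynomial.continuousOn_aeval τb)
      ((Polynomial.continuousOn_aeval τb).add continuousOn_const) hmb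
      (fun x hx y hy hxy => by have h := hmb hx hy hxy; simp only at h ⊢; linarith)
      hbd' A B hB hid' s hs ?_
    have h1 := abs_le.1 (hrg (hbd s hs).2)
    have h0 := abs_le.1 (hrg (hbd 0 (left_mem_Icc.2 zero_le_one)).2)
    show Polynomial.aeval s τb < Polynomial.aeval 0 τb + 3 * b⁻¹
    linarith [inv_pos.2 hb, h1.2, h0.1]
  have hPB : Polynomial.aeval (X 1 : MvPolynomial (Fin 2) ℚ) ca * RB = 0 :=
    stub_digitsMv τb hdegb _ ((FaceRemaindersVanish.degreeOf_zero_aeval_mul_le ca RB).trans_lt hRB)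
      (Icc 0 1) (Icc_infinite zero_lt_one) hτ0b hfb0
  exact FaceRemaindersVanish.eq_zero_of_aeval_mul_eq_zero hca hPB

end Summit.KontsevichZagierPeriods.InverseLandau.TateFamilyKernel.Descent

end
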